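import Summits.CriticalPhenomena.PercolationContinuityZ3.Theorems.Transplant.FKConnectivityAllQAntipodalLevel3All
import Summits.CriticalPhenomena.PercolationContinuityZ3.Theorems.Transplant.FKConnectivityAllQAntipodalOneSum
import HarnessLib

/-!
# Connectivity correlation inequalities for `φ_{w,q}`, every `q > 0` — file 37: level ≤ 3 and U¹¹ ON ONE-SUMS

Support file (`--supports stmt-CriticalPhenomena-4575`), FK sub-lane `prim-bschramm-fk-2` (gen 20); builds on p205010 (kernel theorem,
internal audit signed; external expert review pending).  No definitions, no named facts, no sorries; standard axioms.

The one-sum fold of file 36 (`FK.apPsi_oneSum_eq`, `FK.apPsi_oneSum_nonpos_of`) applied to the top-cell theorems: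
* **`FK.apPsi_level3_oneSum_nonpos_of_isTTSP`** — file 35's `C_∞` at level ≤ 3 for EVERY increasing `f` of three edges `x, y, z` of a
  2-connected series–parallel block `M₁ = E ∪ {st}`, on the one-sum `M₁ ⊔ M₂` with ANY second part `M₂` (vertex supports meeting in at most one
  vertex): `apPsi q (M₁ ∪ M₂) f g ≤ 0` for `g` increasing on the sub-configurations of `M₁ ∪ M₂` not reading `x, y, z`, `0 < q ≤ 1`;
* **`FK.apPsi_pivot_split_oneSum_nonpos_left`** — gen 16's U¹¹ with pivot and split pair all in the block `M₁`, on `M₁ ⊔ M₂`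
  (the fold of `split_{yz}·g` is `split_{yz}·ĝ`).
With `FK.apPsi_pivot_split_oneSum_nonpos` / `…'` (file 36) this is U¹¹ in EVERY position on a one-sum of a 2-connected series–parallel graph
with a part satisfying Theorem U — the top cells of the graphs `H ∖ D` with two blocks, i.e. the two-block deletion cells of `C_∞` (memo
`bschramm/FROM-fk-2-g20-*.md` §2).
[cite: Grimmett2006, §1.4 eq. (1.20) (p. 15); §3.8 Thm. (3.90) (pp. 61–62); §3.9 (pp. 63–64)] [cite: Wagner2006, Thm. 5.8(d), §5.3]
-/

noncomputable section

namespace Summit.CriticalPhenomena.PercolationContinuityZ3.Theorems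

namespace FK

open Literature.Probability.LatticeModels Literature.Probability.Percolation
open scoped Classical

variable {V : Type*} [Fintype V] {E₁ E₂ : Finset (Sym2 V)} {V₁ V₂ : Set V} {m s t : V}

/-- **`C_∞` at level ≤ 3 on one-sums** (`0 < q ≤ 1`): `M₁ = E ∪ {st} ⊆ E₁` (`E` two-terminal series–parallel between `s, t`, `st ∉ E`),
`M₂ ⊆ E₂`, the vertex supports of `E₁, E₂` meeting in at most one vertex; `x, y, z ∈ M₁` distinct; `f` increasing on the subsets of `{x,y,z}`
reading no other edge; `g` increasing on the sub-configurations of `M₁ ∪ M₂` reading none of `x, y, z` ⟹ `apPsi q (M₁ ∪ M₂) f g ≤ 0`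
(`FK.apPsi_oneSum_nonpos_of` + `FK.apPsi_level3_nonpos_of_isTTSP`). [cite: Grimmett2006, §3.8 Thm. (3.90) (pp. 61–62); §3.9 (pp. 63–64)] -/
theorem apPsi_level3_oneSum_nonpos_of_isTTSP {q : ℝ} (hq0 : 0 < q) (hq1 : q ≤ 1) (hd : Disjoint E₁ E₂)
    (h₁ : ∀ e ∈ (↑E₁ : Set (Sym2 V)), ∀ z ∈ e, z ∈ V₁) (h₂ : ∀ e ∈ (↑E₂ : Set (Sym2 V)), ∀ z ∈ e, z ∈ V₂) (hS : V₁ ∩ V₂ ⊆ {m})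
    {E : Finset (Sym2 V)} (hE : IsTTSP E s t) (hst : s(s, t) ∉ E) (hM₁ : insert s(s, t) E ⊆ E₁) {M₂ : Finset (Sym2 V)}
    (hM₂ : M₂ ⊆ E₂) {x y z : Sym2 V} (hx : x ∈ insert s(s, t) E) (hy : y ∈ insert s(s, t) E) (hz : z ∈ insert s(s, t) E)
    (hxy : x ≠ y) (hxz : x ≠ z) (hyz : y ≠ z) {f g : Finset (Sym2 V) → ℝ}
    (hf : ∀ e : Sym2 V, e ∉ ({x, y, z} : Finset (Sym2 V)) → ∀ A : Finset (Sym2 V), f (insert e A) = f A)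
    (hfmono : ∀ ⦃A B : Finset (Sym2 V)⦄, A ⊆ B → B ⊆ ({x, y, z} : Finset (Sym2 V)) → f A ≤ f B)
    (hgx : ∀ A : Finset (Sym2 V), g (insert x A) = g A) (hgy : ∀ A : Finset (Sym2 V), g (insert y A) = g A)
    (hgz : ∀ A : Finset (Sym2 V), g (insert z A) = g A)
    (hmono : ∀ ⦃A B : Finset (Sym2 V)⦄, A ⊆ B → B ⊆ insert s(s, t) E ∪ M₂ → g A ≤ g B) :
    apPsi q (insert s(s, t) E ∪ M₂) f g ≤ 0 := by
  have hdM : Disjoint (insert s(s, t) E) M₂ := Finset.disjoint_of_subset_left hM₁ (Finset.disjoint_of_subset_right hM₂ hd)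
  have hSM₁ : ({x, y, z} : Finset (Sym2 V)) ⊆ insert s(s, t) E := by simp [Finset.insert_subset_iff, hx, hy, hz]
  have hfS := eq_inter_of_notRead_outside hf
  have hfM₂ : ∀ X Y : Finset (Sym2 V), Y ⊆ M₂ → f (X ∪ Y) = f X := fun X Y hY => by
    have hYS : Y ∩ {x, y, z} = ∅ :=
      Finset.disjoint_iff_inter_eq_empty.1 (Finset.disjoint_of_subset_left hY (Finset.disjoint_of_subset_right hSM₁ hdM.symm))
    rw [hfS (X ∪ Y), hfS X, Finset.union_inter_distrib_right, hYS, Finset.union_empty]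
  refine apPsi_oneSum_nonpos_of hq0 hd h₁ h₂ hS hM₁ hM₂ hfM₂ (S := ({x, y, z} : Finset (Sym2 V))) (fun h hS' hm => ?_) ?_ hmono
  · exact apPsi_level3_nonpos_of_isTTSP hq0 hq1 hE hst hx hy hz hxy hxz hyz hf hfmono (hS' x (by simp)) (hS' y (by simp))
      (hS' z (by simp)) hm
  · intro e he A
    simp only [Finset.mem_insert, Finset.mem_singleton] at he
    rcases he with rfl | rfl | rfl
    exacts [hgx A, hgy A, hgz A]

/-- **U¹¹ with pivot and split pair in the block** (`0 < q ≤ 1`): `x, y, z ∈ M₁ = E ∪ {st}` distinct, `M₂` ANY second part meeting `M₁`'s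
support in at most one vertex, `g` increasing on the sub-configurations of `M₁ ∪ M₂` reading none of `x, y, z` ⟹
`apPsi q (M₁ ∪ M₂) 1_x (split_{yz}·g) ≤ 0`: the fold of `split_{yz}·g` is `split_{yz}·ĝ` (`y, z ∉ M₂`), and gen 16's U¹¹ applies to `ĝ`
(`FK.apPsi_pivot_split_nonpos_of_isTTSP`). [cite: Grimmett2006, §3.8 Thm. (3.90) (pp. 61–62); §3.9 (pp. 63–64)] -/
theorem apPsi_pivot_split_oneSum_nonpos_left {q : ℝ} (hq0 : 0 < q) (hq1 : q ≤ 1) (hd : Disjoint E₁ E₂)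
    (h₁ : ∀ e ∈ (↑E₁ : Set (Sym2 V)), ∀ z ∈ e, z ∈ V₁) (h₂ : ∀ e ∈ (↑E₂ : Set (Sym2 V)), ∀ z ∈ e, z ∈ V₂) (hS : V₁ ∩ V₂ ⊆ {m})
    {E : Finset (Sym2 V)} (hE : IsTTSP E s t) (hst : s(s, t) ∉ E) (hM₁ : insert s(s, t) E ⊆ E₁) {M₂ : Finset (Sym2 V)}
    (hM₂ : M₂ ⊆ E₂) {x y z : Sym2 V} (hx : x ∈ insert s(s, t) E) (hy : y ∈ insert s(s, t) E) (hz : z ∈ insert s(s, t) E)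
    (hxy : x ≠ y) (hxz : x ≠ z) (hyz : y ≠ z) {g : Finset (Sym2 V) → ℝ}
    (hgx : ∀ A : Finset (Sym2 V), g (insert x A) = g A) (hgy : ∀ A : Finset (Sym2 V), g (insert y A) = g A)
    (hgz : ∀ A : Finset (Sym2 V), g (insert z A) = g A)
    (hmono : ∀ ⦃A B : Finset (Sym2 V)⦄, A ⊆ B → B ⊆ insert s(s, t) E ∪ M₂ → g A ≤ g B) :
    apPsi q (insert s(s, t) E ∪ M₂) (fun A => if x ∈ A then 1 else 0) (fun A => splitInd y z A * g A) ≤ 0 := by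
  set M₁ := insert s(s, t) E with hM₁def
  have hdM : Disjoint M₁ M₂ := Finset.disjoint_of_subset_left hM₁ (Finset.disjoint_of_subset_right hM₂ hd)
  have hxM₂ : x ∉ M₂ := fun h => Finset.disjoint_left.1 hdM hx h
  have hyM₂ : y ∉ M₂ := fun h => Finset.disjoint_left.1 hdM hy h
  have hzM₂ : z ∉ M₂ := fun h => Finset.disjoint_left.1 hdM hz h
  have hf : ∀ X Y : Finset (Sym2 V), Y ⊆ M₂ → (fun A : Finset (Sym2 V) => if x ∈ A then (1 : ℝ) else 0) (X ∪ Y) =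
      (fun A : Finset (Sym2 V) => if x ∈ A then (1 : ℝ) else 0) X := fun X Y hY => by
    have hxY : x ∉ Y := fun h => hxM₂ (hY h)
    simp only [Finset.mem_union, hxY, or_false]
  have key := apPsi_oneSum_eq q hd h₁ h₂ hS hM₁ hM₂ (f := fun A => if x ∈ A then (1 : ℝ) else 0) hf
    (fun A => splitInd y z A * g A)
  -- the fold of `split·g` is `split·ĝ`
  have hfold : (fun β : Finset (Sym2 V) => ∑ γ₂ ∈ M₂.powerset, q ^ apExp M₂ γ₂ * (splitInd y z (β ∪ γ₂) * g (β ∪ γ₂))) =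
      fun β => splitInd y z β * ∑ γ₂ ∈ M₂.powerset, q ^ apExp M₂ γ₂ * g (β ∪ γ₂) := by
    funext β
    rw [Finset.mul_sum]
    refine Finset.sum_congr rfl fun γ₂ hγ₂ => ?_
    have hyγ : y ∉ γ₂ := fun h => hyM₂ (Finset.mem_powerset.1 hγ₂ h)
    have hzγ : z ∉ γ₂ := fun h => hzM₂ (Finset.mem_powerset.1 hγ₂ h)
    have hsp : splitInd y z (β ∪ γ₂) = splitInd y z β := by
      unfold splitInd; simp only [Finset.mem_union, hyγ, hzγ, or_false]
    rw [hsp]; ring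
  rw [hfold] at key
  have hle := apPsi_pivot_split_nonpos_of_isTTSP hq0 hq1 hE hst hx hy hz hxy hxz hyz
    (g := fun β => ∑ γ₂ ∈ M₂.powerset, q ^ apExp M₂ γ₂ * g (β ∪ γ₂))
    (fun A => oneSumFold_insert q M₂ hgx A) (fun A => oneSumFold_insert q M₂ hgy A) (fun A => oneSumFold_insert q M₂ hgz A)
    (fun A B hAB hB => oneSumFold_mono hq0.le hmono hAB hB)
  rw [← key] at hle
  exact le_of_mul_le_mul_left (by rw [mul_zero]; exact hle) (pow_pos hq0 _)

end FK

end Summit.CriticalPhenomena.PercolationContinuityZ3.Theorems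

end
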